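import Literature.NumberTheory.LFunctions.CertifiedDirichletLTuringHadamard
import Literature.NumberTheory.LFunctions.CertifiedDirichletLTuringTrudgianProofs
import Mathlib.Analysis.Complex.ExponentialBounds
import HarnessLib

/-!
# Turing's method for Dirichlet `L`-functions, assembled: Trudgian's Theorem 3.8 in pair form and the
# GRH-verification step, conditional only on Booker's inequality (Trudgian 2011, §3.4; Platt 2016, §3)

Final layer of the Dirichlet-`L` Turing files (`CertifiedDirichletLTuringMethodZeroCountProofs`,
`…TrudgianProofs`, `…LowerBound`, `…Hadamard`).  Everything here is a theorem; no new named fact.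

"Lemmas 3.4, 3.6 and 3.7 prove at once Theorem 3.8" [Trudgian 2011, §3.4]: Littlewood's lemma
(`TuringDirichlet.pi_mul_integral_lfunctionArgS_eq`), the upper bound Lemma 3.6
(`Trudgian2011Dirichlet.trudgian2011_lemma36`) at height `t₂` for `χ` and for `χ̄`, and the lower bound
Lemma 3.7 in pair form (`TuringDirichlet.neg_setIntegral_log_norm_LFunction_pair_le`) at height `t₁`
give

* `TuringDirichlet.pi_mul_integral_lfunctionArgS_pair_le` — **Theorem 3.8, pair form:** for a
  primitive `χ` modulo `Q > 1`, parameters `1 < c ≤ 5/4`, `½ < d ≤ 1`, and `1 ≤ t₀ < t₁ ≤ t₂` with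
  `t₁, t₂` ordinates of no zero of `L(s,χ)L(s,χ̄)` in the critical strip,
  `π (∫_{t₁}^{t₂} S(t,χ) dt + ∫_{t₁}^{t₂} S(t,χ̄) dt) ≤ 2(a₁ + a₂) + 2(b₁ + b₂) log(Qt₂/2π)`, with
  `a₁ = 729/(2048t₀²) + (c−½) log ζ(c) + ∫_c^∞ log ζ`, `b₁ = ¼(c−½)²` (Lemma 3.6 as printed),
  `b₂ = (d²/2)(log 4 − 1)` (as printed) and
  `a₂ = d² log 4 (2ζ'/ζ(1+2d) − ζ'/ζ(½+d) + ε'(t₀)) + d² ε(t₀) − I(d)` — Trudgian's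
  `a₂ = 13d²/t₀² − d²(log 4) ζ'/ζ(½+d) − [I(d) written out]` up to the explicit Stirling errors
  `ε = turingEps`, `ε' = turingEps'` of the tree's `ζ` file and Booker's refinement `2ζ'/ζ(1+2d) ≤ 0`;
  conditional on `Trudgian2011_lemma_2_10` (Booker's inequality, Trudgian's Lemma 2.7) exactly as the
  tree's `ζ` Theorem 2.12 (`abs_integral_zetaArgS_le_trudgian_thm_2_12`).
* `LFunctionRHUpTo.of_turing_booker` — **the GRH-verification step for `χ` up to height `T`**
  (Platt 2016 Thm. 3.2 + Trudgian Thm. 3.8): found zeros on the critical line below `T` and just above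
  `T` for `χ`, `χ̄`, plus ONE explicit real inequality, certify `LFunctionRHUpTo χ T` and the exact zero
  count — conditional only on `Trudgian2011_lemma_2_10` (and no longer on `rumely1993_theorem2`).

## References
* T. S. Trudgian, Improvements to Turing's method, Math. Comp. 80 (2011) 2259–2279, §3.4 Theorem 3.8
  (arXiv:0903.1885 p. 10). [Trudgian2011]
* D. J. Platt, Numerical computations concerning the GRH, Math. Comp. 85 (2016), Thm. 3.2–3.3.
  [Platt2016GRH]
* A. R. Booker, Experiment. Math. 15 (2006), Lemma 4.4, Theorem 4.6. [Booker2006]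
-/

noncomputable section

open Complex Set MeasureTheory intervalIntegral Filter Topology
open scoped Real ComplexConjugate

namespace Literature.NumberTheory.LFunctions

open DirichletTheta DirichletCharacter ExplicitPsiChar Trudgian2011Dirichlet

namespace TuringDirichlet

variable {q : ℕ} [NeZero q] {χ : DirichletCharacter ℂ q}

omit [NeZero q] in
/-- The inverse of a primitive character is primitive. [folklore] -/
private theorem isPrimitive_inv₃ (hχ : χ.IsPrimitive) : χ⁻¹.IsPrimitive := by
  rw [DirichletCharacter.isPrimitive_def, DirichletCharacter.conductor_inv]; exact hχ

/-- `t` is the ordinate of no non-trivial zero of `L(s, χ̄)` iff `−t` is the ordinate of none of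
`L(s, χ)`. [folklore] -/
private theorem forall_im_ne_inv₃ (h1 : χ ≠ 1) {t : ℝ}
    (ht : ∀ ρ ∈ charNontrivialZeros χ, ρ.im ≠ -t) : ∀ ρ ∈ charNontrivialZeros χ⁻¹, ρ.im ≠ t := by
  intro ρ hρ h
  have hρ' : conj ρ ∈ charNontrivialZeros χ := by
    have := (conj_mem_charNontrivialZeros_inv (χ := χ⁻¹) (inv_ne_one.mpr h1) (ρ := ρ)).2 hρ
    rwa [inv_inv] at this
  exact ht _ hρ' (by rw [Complex.conj_im, h])

omit [NeZero q] in
/-- `log(Qt/2π) = log Q + log t − log 2 − log π`. [folklore] -/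
private theorem log_qt_eq (hq : 0 < (q : ℝ)) {t : ℝ} (ht : 0 < t) :
    Real.log (q * t / (2 * π)) = Real.log q + Real.log t - Real.log 2 - Real.log π := by
  rw [Real.log_div (by positivity) (by positivity), Real.log_mul hq.ne' ht.ne',
    Real.log_mul two_ne_zero Real.pi_ne_zero]
  ring

/-- `log 4 ≥ 1` (`e < 4`). [folklore] -/
private theorem one_le_log_four : 1 ≤ Real.log 4 := by
  rw [Real.le_log_iff_exp_le (by norm_num)]
  have := Real.exp_one_lt_three
  linarith

/-- **Trudgian 2011, Theorem 3.8 in pair form (conditional on Booker's inequality).**  For a primitive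
`χ` modulo `Q > 1`, `1 < c ≤ 5/4`, `½ < d ≤ 1`, `1 ≤ t₀ < t₁ ≤ t₂`, `t₁` and `t₂` ordinates of no zero
of `L(s,χ)` or `L(s,χ̄)` with `0 < Re s < 1`:
`π(∫_{t₁}^{t₂} S(t,χ)dt + ∫_{t₁}^{t₂} S(t,χ̄)dt) ≤ 2(a₁ + a₂) + 2(b₁ + b₂) log(Qt₂/2π)`,
`a₁ = 729/(2048t₀²) + (c−½) log ζ(c) + ∫_c^∞ log ζ`, `b₁ = ¼(c−½)²`, `b₂ = (d²/2)(log 4 − 1)`,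
`a₂ = d² log 4·(2ζ'/ζ(1+2d) − ζ'/ζ(½+d) + ε'(t₀)) + d² ε(t₀) − I(d)` (`I = turingI`, `ε = turingEps`,
`ε' = turingEps'`).  As printed (for one `χ`, with `a₂ = 13d²/t₀² − d² log 4 ζ'/ζ(½+d) − …`):
"If `t₂ > t₁ > t₀ > 50` and `1 < c ≤ 5/4`, `½ < d ≤ 1`, then `|∫_{t₁}^{t₂} S(t,χ) dt| ≤ a + b log(Qt₂/2π)`,
`aπ = (c−½)log ζ(c) + ∫_c^∞ log ζ − d²(log 4)ζ'/ζ(½+d) − ½∫_{2d+1}^∞ log ζ + ∫_{½+d}^∞ log ζ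
− ½∫_{2d+1}^{4d+1} log ζ + ∫_{½+d}^{½+2d} log ζ + 15d²/t₀²`, `2bπ = ½(c−½)² + d²(log 4 − 1)`."
[cite: Trudgian2011, §3.4 Theorem 3.8] -/
theorem pi_mul_integral_lfunctionArgS_pair_le (hB : Trudgian2011_lemma_2_10) (hq : 1 < q)
    (hχ : χ.IsPrimitive) {c d t₀ t₁ t₂ : ℝ} (hc1 : 1 < c) (hc : c ≤ 5 / 4) (hd : 1 / 2 < d)
    (hd1 : d ≤ 1) (ht₀ : 1 ≤ t₀) (h01 : t₀ < t₁) (h12 : t₁ ≤ t₂)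
    (hz₁ : ∀ ρ ∈ charNontrivialZeros χ, ρ.im ≠ t₁) (hz₁' : ∀ ρ ∈ charNontrivialZeros χ⁻¹, ρ.im ≠ t₁)
    (hz₂ : ∀ ρ ∈ charNontrivialZeros χ, ρ.im ≠ t₂) (hz₂' : ∀ ρ ∈ charNontrivialZeros χ⁻¹, ρ.im ≠ t₂) :
    π * ((∫ t in t₁..t₂, lfunctionArgS χ t) + ∫ t in t₁..t₂, lfunctionArgS χ⁻¹ t) ≤
      2 * ((729 / (2048 * t₀ ^ 2) + (c - 1 / 2) * logZeta c + ∫ σ in Ioi c, logZeta σ) +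
          (d ^ 2 * Real.log 4 *
              ((2 * (deriv riemannZeta (2 * (1 / 2 + d) : ℝ) / riemannZeta (2 * (1 / 2 + d) : ℝ)).re -
                  (deriv riemannZeta (1 / 2 + d : ℝ) / riemannZeta (1 / 2 + d : ℝ)).re) +
                turingEps' t₀) +
            d ^ 2 * turingEps t₀ - turingI d)) +
        2 * ((c - 1 / 2) ^ 2 / 4 + d ^ 2 / 2 * (Real.log 4 - 1)) * Real.log (q * t₂ / (2 * π)) := by
  have hq1 : q ≠ 1 := by omega
  have hqR : (0 : ℝ) < q := by exact_mod_cast (show 0 < q by omega)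
  have h1 : χ ≠ 1 := SelbergDirichlet.ne_one_of_isPrimitive hq1 hχ
  have hχ' : χ⁻¹.IsPrimitive := isPrimitive_inv₃ hχ
  have ht₀0 : 0 < t₀ := by linarith
  have ht₁ : 1 ≤ t₁ := by linarith
  have ht₁0 : 0 < t₁ := by linarith
  have ht₂0 : 0 < t₂ := by linarith
  -- Littlewood for `χ` and `χ̄`
  have hLw := pi_mul_integral_lfunctionArgS_eq hχ hq h12 hz₁ hz₂
  have hLw' := pi_mul_integral_lfunctionArgS_eq hχ' hq h12 hz₁' hz₂'
  -- Lemma 3.6 at `t₂`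
  have hU := trudgian2011_lemma36 hq hχ hc1 hc ht₀0 (h01.trans_le h12) hz₂
  have hU' := trudgian2011_lemma36 hq hχ' hc1 hc ht₀0 (h01.trans_le h12) hz₂'
  -- Lemma 3.7 (pair) at `t₁`
  have hL := neg_setIntegral_log_norm_LFunction_pair_le hB hq hχ hd hd1 ht₁ hz₁ hz₁'
  -- monotonicity of the error terms and of the logarithm
  have hε := turingEps_le ht₀0 h01.le
  have hε' := turingEps'_le ht₀0 h01.le
  have hlog4 : 0 ≤ d ^ 2 * Real.log 4 := by
    have := one_le_log_four; positivity
  have hd2 : 0 ≤ d ^ 2 := sq_nonneg d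
  have hb₂ : 0 ≤ d ^ 2 / 2 * (Real.log 4 - 1) := by
    have := one_le_log_four
    exact mul_nonneg (by positivity) (by linarith)
  have hlog₁ := log_qt_eq hqR ht₁0
  have hlog₂ := log_qt_eq hqR ht₂0
  have hmono : Real.log (q * t₁ / (2 * π)) ≤ Real.log (q * t₂ / (2 * π)) := by
    refine Real.log_le_log (by positivity) ?_
    gcongr
  have hm1 := mul_le_mul_of_nonneg_left hε' hlog4
  have hm2 := mul_le_mul_of_nonneg_left hε hd2
  have hm3 := mul_le_mul_of_nonneg_left hmono hb₂
  rw [mul_add, hLw, hLw']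
  rw [hlog₁] at hm3
  rw [hlog₂] at hU hU' hm3 ⊢
  linarith

end TuringDirichlet

open TuringDirichlet Trudgian2011Dirichlet in
/-- **The GRH-verification step for `L(s, χ)` up to height `T`, conditional only on Booker's
inequality** (Platt 2016 Thm. 3.2 with Trudgian's Thm. 3.8 plugged in; the shape of Platt's and
Rumely's verifications).  Data, for a primitive `χ` of conductor `q > 1` and `1 ≤ t₀ < T`, `h > 0`,
`±T` and `±(T+h)` ordinates of no non-trivial zero of `L(s, χ)`: (i) `n` distinct ordinates `γ`,
`|γ| ≤ T`, of zeros of `L(s, χ)` on the critical line; (ii) found zeros `Z`, `Z'` of `L(s,χ)`,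
`L(s,χ̄)` on the line with ordinates in `(T, T+h]`; (iii) parameters `1 < c ≤ 5/4`, `½ < d ≤ 1` and
the single real inequality `B/π + (2/π)∫_T^{T+h} θ(t,χ)dt − Σ_Z(T+h−γ) − Σ_{Z'}(T+h−γ) < h(n+1)`,
`B = 2(a₁ + a₂) + 2(b₁ + b₂) log(q(T+h)/2π)` the bound of `pi_mul_integral_lfunctionArgS_pair_le`.
Conclusion: `LFunctionRHUpTo χ T ∧ N_χ(T) = N_{χ,0}(T) = n`.  What remains unformalised is Booker's
inequality (`Trudgian2011_lemma_2_10`, a one-variable real inequality) and the certified numerics.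
[cite: Platt2016GRH, Theorem 3.2] [cite: Trudgian2011, §3.4 Theorem 3.8] -/
theorem LFunctionRHUpTo.of_turing_booker (hB : Trudgian2011_lemma_2_10) {q : ℕ} [NeZero q]
    {χ : DirichletCharacter ℂ q} (hχ : χ.IsPrimitive) (hq : 1 < q) {c d t₀ T h : ℝ} {n : ℕ}
    (hc1 : 1 < c) (hc : c ≤ 5 / 4) (hd : 1 / 2 < d) (hd1 : d ≤ 1) (ht₀ : 1 ≤ t₀) (hT : t₀ < T)
    (hh : 0 < h)
    (hz : ∀ ρ ∈ charNontrivialZeros χ, ρ.im ≠ T ∧ ρ.im ≠ -T)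
    (hzh : ∀ ρ ∈ charNontrivialZeros χ, ρ.im ≠ T + h ∧ ρ.im ≠ -(T + h))
    (W : Finset ℝ) (hW : ∀ γ ∈ W, χ.LFunction (1 / 2 + γ * I) = 0 ∧ |γ| ≤ T) (hWn : W.card = n)
    (Z : Finset ℝ) (hZ : ∀ γ ∈ Z, χ.LFunction (1 / 2 + γ * I) = 0 ∧ T < γ ∧ γ ≤ T + h)
    (Z' : Finset ℝ) (hZ' : ∀ γ ∈ Z', χ⁻¹.LFunction (1 / 2 + γ * I) = 0 ∧ T < γ ∧ γ ≤ T + h)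
    (hnum : (2 * ((729 / (2048 * t₀ ^ 2) + (c - 1 / 2) * logZeta c + ∫ σ in Ioi c, logZeta σ) +
          (d ^ 2 * Real.log 4 *
              ((2 * (deriv riemannZeta (2 * (1 / 2 + d) : ℝ) / riemannZeta (2 * (1 / 2 + d) : ℝ)).re -
                  (deriv riemannZeta (1 / 2 + d : ℝ) / riemannZeta (1 / 2 + d : ℝ)).re) +
                turingEps' t₀) +
            d ^ 2 * turingEps t₀ - turingI d)) +
        2 * ((c - 1 / 2) ^ 2 / 4 + d ^ 2 / 2 * (Real.log 4 - 1)) * Real.log (q * (T + h) / (2 * π))) / π +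
        2 / π * (∫ t in T..T + h, lfunctionTheta χ t) - ∑ γ ∈ Z, (T + h - γ) -
        ∑ γ ∈ Z', (T + h - γ) < h * (n + 1)) :
    LFunctionRHUpTo χ T ∧ lfunctionZeroCount χ T = n ∧ lfunctionCriticalZeroCount χ T = n := by
  have hq1 : q ≠ 1 := by omega
  have h1 : χ ≠ 1 := SelbergDirichlet.ne_one_of_isPrimitive hq1 hχ
  have hz₁ : ∀ ρ ∈ charNontrivialZeros χ, ρ.im ≠ T := fun ρ hρ ↦ (hz ρ hρ).1
  have hz₁' : ∀ ρ ∈ charNontrivialZeros χ⁻¹, ρ.im ≠ T :=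
    forall_im_ne_inv₃ h1 fun ρ hρ ↦ (hz ρ hρ).2
  have hz₂ : ∀ ρ ∈ charNontrivialZeros χ, ρ.im ≠ T + h := fun ρ hρ ↦ (hzh ρ hρ).1
  have hz₂' : ∀ ρ ∈ charNontrivialZeros χ⁻¹, ρ.im ≠ T + h :=
    forall_im_ne_inv₃ h1 fun ρ hρ ↦ (hzh ρ hρ).2
  have hS := pi_mul_integral_lfunctionArgS_pair_le hB hq hχ hc1 hc hd hd1 ht₀ hT (by linarith)
    hz₁ hz₁' hz₂ hz₂'
  have hπ := Real.pi_pos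
  have hS' : (∫ t in T..T + h, lfunctionArgS χ t) + ∫ t in T..T + h, lfunctionArgS χ⁻¹ t ≤
      (2 * ((729 / (2048 * t₀ ^ 2) + (c - 1 / 2) * logZeta c + ∫ σ in Ioi c, logZeta σ) +
          (d ^ 2 * Real.log 4 *
              ((2 * (deriv riemannZeta (2 * (1 / 2 + d) : ℝ) / riemannZeta (2 * (1 / 2 + d) : ℝ)).re -
                  (deriv riemannZeta (1 / 2 + d : ℝ) / riemannZeta (1 / 2 + d : ℝ)).re) +
                turingEps' t₀) +
            d ^ 2 * turingEps t₀ - turingI d)) +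
        2 * ((c - 1 / 2) ^ 2 / 4 + d ^ 2 / 2 * (Real.log 4 - 1)) *
          Real.log (q * (T + h) / (2 * π))) / π := by
    rw [le_div_iff₀ hπ, mul_comm]
    exact hS
  exact LFunctionRHUpTo.of_turing hχ hq (by linarith) hh.le hz W hW hWn Z hZ Z' hZ' hS' hnum

end Literature.NumberTheory.LFunctions

end
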